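import Summits.QuantumFields.YangMills.Theorems.SandwichVariancePinchingScoreIdentities

/-!
# Log-concave MEAN–MODE GAP under the second-difference sandwich — the SMOOTH (C²) case
# (helper toward crux ⟨stmt-QuantumFields-24006⟩ `AllWindowsColdBox.BulkMidWindowSU2`, crux idea
# `logconcave-core-extension`, typed engine `SandwichMeanNearMode` of
# `Cruxes/BulkMidWindowSU2/LogConcaveCoreExtensionSketch.lean`)

Setting: `A ∈ C²(ℝⁿ)` (`ℝⁿ = Fin n → ℝ`, Lebesgue measure) with the WHITENED second-difference sandwich
`(1−δ)|h|² ≤ A(x+h) + A(x−h) − 2A(x) ≤ (1+δ)|h|²`, `0 ≤ δ < 1`, and an arbitrary base point `x₀`.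
Writing `Z = ∫e^{−A}`, `I_w = ∫ w·(x−x₀) e^{−A}`, `V = ∫ |x−x₀|² e^{−A}`:

* §1 pointwise calculus from the sandwich: polarisation `|D²A(z)(u,w) − u·w| ≤ (δ/2)(|u|²+|w|²)`
  (`abs_fderiv_fderiv_sub_dot_le`); the DESCENT inequality `f(x+v) ≤ f(x) + Df(x)v + (K/2)|v|²`
  for `C²` functions with second differences `≤ K|h|²` (`meanMode_descent`); STRONG MONOTONICITY of the
  gradient `Df(x)(x−x₀) ≥ Df(x₀)(x−x₀) + K|x−x₀|²` when second differences are `≥ K|h|²`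
  (`meanMode_fderiv_strongMono`); the MIXED LIPSCHITZ bound
  `|DA(x)w − DA(x₀)w − (x−x₀)·w| ≤ (δ/2)(|x−x₀|² + |w|²)` (`meanMode_abs_fderiv_defect_le`).
* §2 two integration-by-parts identities (the tree's `integral_mul_fderiv_affine_mul_exp_neg` with `F ≡ 1`):
  `∫ ∂_wA e^{−A} = 0` and `∫ ∂_{x−x₀}A e^{−A} = n·Z`.
* §3 the two SMOOTH-CASE inequalities consumed by the mollification step of the sibling file
  `…AllWindowsColdBoxBulkMidSandwichMeanNearMode`:  (S1) `|I_w + ∂_wA(x₀)·Z| ≤ (δ/2)(V + |w|²Z)`  (`meanMode_firstMoment_smooth`),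
  (S2) `(1−δ)V ≤ nZ − ∫ ∂_{x−x₀}A(x₀) e^{−A}`  (`meanMode_secondMoment_smooth`).
  At a critical point `x₀` (S1)+(S2) give `|I_w|/Z ≤ (δ/2)(n/(1−δ) + |w|²)`, whence, by scaling `w`,
  the mean–mode gap `|E_A[w·(x−x₀)]| ≤ δ·√(n/(1−δ))·|w|`.

HONEST SCOPE.  Free-hands work of the LEAD seat of ⟨stmt-QuantumFields-24006⟩ (cell ym-idea-1 / FCL lineage) on
the typed piece P3b of an UN-TRIAGED crux idea card; pure log-concave probability over the tree's
`SandwichVariancePinching` toolkit.  It proves no stub of LINE-18, not the crux, no rung and no summit; the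
Yang–Mills mass gap is NOT proved by any of this.
-/

noncomputable section

namespace Summit.QuantumFields.YangMills.Theorems.SandwichVariancePinching

open MeasureTheory Real Filter Topology

variable {n : ℕ}

/-! ## §1 Pointwise calculus from the sandwich -/

/-- POLARISATION OF THE HESSIAN DEFECT: under the whitened sandwich a `C²` potential has
`|D²A(z)(u,w) − u·w| ≤ (δ/2)(|u|² + |w|²)`. [folklore] -/
theorem abs_fderiv_fderiv_sub_dot_le {A : (Fin n → ℝ) → ℝ} (hA : ContDiff ℝ 2 A) {δ : ℝ}
    (hsw : ∀ x h : Fin n → ℝ, (1 - δ) * (h ⬝ᵥ h) ≤ A (x + h) + A (x - h) - 2 * A x ∧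
      A (x + h) + A (x - h) - 2 * A x ≤ (1 + δ) * (h ⬝ᵥ h)) (z u w : Fin n → ℝ) :
    |fderiv ℝ (fderiv ℝ A) z u w - u ⬝ᵥ w| ≤ δ / 2 * (u ⬝ᵥ u + w ⬝ᵥ w) := by
  set B := fderiv ℝ (fderiv ℝ A) z with hB
  have hdiag : ∀ v : Fin n → ℝ, |B v v - v ⬝ᵥ v| ≤ δ * (v ⬝ᵥ v) := by
    intro v
    have hup := fderiv_fderiv_le_of_secondDiff_le hA (fun y h => (hsw y h).2) z v
    have hlo := le_fderiv_fderiv_of_le_secondDiff hA (fun y h => (hsw y h).1) z v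
    rw [abs_le]
    constructor <;> linarith
  have hsymm : B w u = B u w := fderiv_fderiv_symm hA z w u
  have hpol : B u w - u ⬝ᵥ w =
      ((B (u + w) (u + w) - (u + w) ⬝ᵥ (u + w)) - (B (u - w) (u - w) - (u - w) ⬝ᵥ (u - w))) / 4 := by
    have h1 : B (u + w) (u + w) = B u u + B u w + B w u + B w w := by
      simp only [map_add, add_apply]; ring
    have h2 : B (u - w) (u - w) = B u u - B u w - B w u + B w w := by
      simp only [map_sub, sub_apply]; ring
    have h3 : (u + w) ⬝ᵥ (u + w) = u ⬝ᵥ u + 2 * (u ⬝ᵥ w) + w ⬝ᵥ w := by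
      simp only [add_dotProduct, dotProduct_add, dotProduct_comm w u]; ring
    have h4 : (u - w) ⬝ᵥ (u - w) = u ⬝ᵥ u - 2 * (u ⬝ᵥ w) + w ⬝ᵥ w := by
      simp only [sub_dotProduct, dotProduct_sub, dotProduct_comm w u]; ring
    rw [h1, h2, h3, h4, hsymm]; ring
  have hs : (u + w) ⬝ᵥ (u + w) + (u - w) ⬝ᵥ (u - w) = 2 * (u ⬝ᵥ u + w ⬝ᵥ w) := by
    simp only [add_dotProduct, dotProduct_add, sub_dotProduct, dotProduct_sub, dotProduct_comm w u]
    ring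
  have hp := hdiag (u + w)
  have hm := hdiag (u - w)
  rw [hpol, abs_div, abs_of_pos (by norm_num : (0:ℝ) < 4)]
  have ht := abs_sub (B (u + w) (u + w) - (u + w) ⬝ᵥ (u + w)) (B (u - w) (u - w) - (u - w) ⬝ᵥ (u - w))
  have hK : δ / 2 * (u ⬝ᵥ u + w ⬝ᵥ w) =
      (δ * ((u + w) ⬝ᵥ (u + w)) + δ * ((u - w) ⬝ᵥ (u - w))) / 4 := by
    rw [← mul_add, hs]; ring
  rw [hK]
  exact div_le_div_of_nonneg_right (ht.trans (add_le_add hp hm)) (by norm_num)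

/-- The affine path `t ↦ x + t•v` has velocity `v`. [folklore] -/
theorem meanMode_hasDerivAt_path (x v : Fin n → ℝ) (t : ℝ) :
    HasDerivAt (fun s : ℝ => x + s • v) v t := by
  simpa using ((hasDerivAt_id t).smul_const v).const_add x

/-- Along the affine path, `t ↦ f(x + t•v)` has derivative `Df(x+t•v)v` (`f ∈ C²`). [folklore] -/
theorem meanMode_hasDerivAt_comp_path {f : (Fin n → ℝ) → ℝ} (hf : ContDiff ℝ 2 f)
    (x v : Fin n → ℝ) (t : ℝ) :
    HasDerivAt (fun s : ℝ => f (x + s • v)) (fderiv ℝ f (x + t • v) v) t := by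
  have hd : HasFDerivAt f (fderiv ℝ f (x + t • v)) (x + t • v) :=
    (hf.differentiable (by norm_num) _).hasFDerivAt
  exact hd.comp_hasDerivAt t (meanMode_hasDerivAt_path x v t)

/-- Along the affine path, `t ↦ Df(x + t•v)w` has derivative `D²f(x+t•v)(v)(w)` (`f ∈ C²`). [folklore] -/
theorem meanMode_hasDerivAt_fderiv_comp_path {f : (Fin n → ℝ) → ℝ} (hf : ContDiff ℝ 2 f)
    (x v w : Fin n → ℝ) (t : ℝ) :
    HasDerivAt (fun s : ℝ => fderiv ℝ f (x + s • v) w) (fderiv ℝ (fderiv ℝ f) (x + t • v) v w) t := by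
  have hd2 : HasFDerivAt (fderiv ℝ f) (fderiv ℝ (fderiv ℝ f) (x + t • v)) (x + t • v) :=
    (((hf.fderiv_right (m := 1) (by norm_num)).differentiable (by norm_num)) _).hasFDerivAt
  have h2 : HasDerivAt (fun s : ℝ => fderiv ℝ f (x + s • v)) (fderiv ℝ (fderiv ℝ f) (x + t • v) v) t :=
    hd2.comp_hasDerivAt t (meanMode_hasDerivAt_path x v t)
  have h3 := h2.clm_apply (hasDerivAt_const t w)
  simpa using h3

/-- **DESCENT INEQUALITY**: a `C²` function whose second differences are `≤ K|h|²` satisfies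
`f(x + v) ≤ f(x) + Df(x)v + (K/2)|v|²`. [folklore] -/
theorem meanMode_descent {f : (Fin n → ℝ) → ℝ} (hf : ContDiff ℝ 2 f) {K : ℝ}
    (h2 : ∀ x h : Fin n → ℝ, f (x + h) + f (x - h) - 2 * f x ≤ K * (h ⬝ᵥ h)) (x v : Fin n → ℝ) :
    f (x + v) ≤ f x + fderiv ℝ f x v + K / 2 * (v ⬝ᵥ v) := by
  -- `q t = Df(x+t v) v` grows at most like `K|v|² t`
  set q : ℝ → ℝ := fun t => fderiv ℝ f (x + t • v) v with hq
  have hq' : ∀ t, HasDerivAt q (fderiv ℝ (fderiv ℝ f) (x + t • v) v v) t := fun t =>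
    meanMode_hasDerivAt_fderiv_comp_path hf x v v t
  have hqd : Differentiable ℝ q := fun t => (hq' t).differentiableAt
  have hqle : ∀ t, deriv q t ≤ K * (v ⬝ᵥ v) := fun t => by
    rw [(hq' t).deriv]; exact fderiv_fderiv_le_of_secondDiff_le hf h2 _ v
  have hq1 : ∀ t, 0 ≤ t → q t - q 0 ≤ K * (v ⬝ᵥ v) * t := fun t ht => by
    have := image_sub_le_mul_sub_of_deriv_le hqd hqle ht
    simpa using this
  -- `G t = f(x+t v) − t q(0) − (K/2)|v|² t²` is non-increasing on `[0, ∞)`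
  set G : ℝ → ℝ := fun t => f (x + t • v) - t * q 0 - K / 2 * (v ⬝ᵥ v) * t ^ 2 with hG
  have hG' : ∀ t, HasDerivAt G (q t - q 0 - K * (v ⬝ᵥ v) * t) t := by
    intro t
    have h1 : HasDerivAt (fun s : ℝ => f (x + s • v)) (q t) t := meanMode_hasDerivAt_comp_path hf x v t
    have h2' : HasDerivAt (fun s : ℝ => s * q 0) (q 0) t := by
      simpa using hasDerivAt_mul_const (q 0) (x := t)
    have h3 : HasDerivAt (fun s : ℝ => K / 2 * (v ⬝ᵥ v) * s ^ 2) (K / 2 * (v ⬝ᵥ v) * (2 * t)) t := by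
      have := (hasDerivAt_pow 2 t).const_mul (K / 2 * (v ⬝ᵥ v))
      simpa using this
    have h := (h1.sub h2').sub h3
    have e : q t - q 0 - K / 2 * (v ⬝ᵥ v) * (2 * t) = q t - q 0 - K * (v ⬝ᵥ v) * t := by ring
    rw [e] at h
    exact h
  have hGc : ContinuousOn G (Set.Ici 0) := fun t _ => (hG' t).continuousAt.continuousWithinAt
  have hGd : DifferentiableOn ℝ G (interior (Set.Ici 0)) := fun t _ =>
    (hG' t).differentiableAt.differentiableWithinAt
  have hGle : ∀ t ∈ interior (Set.Ici (0:ℝ)), deriv G t ≤ 0 := by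
    intro t ht
    rw [interior_Ici] at ht
    rw [(hG' t).deriv]
    have := hq1 t (le_of_lt ht)
    linarith
  have key := (convex_Ici (0:ℝ)).image_sub_le_mul_sub_of_deriv_le hGc hGd hGle 0
    (Set.mem_Ici.mpr le_rfl) 1 (Set.mem_Ici.mpr zero_le_one) zero_le_one
  simp only [hG, hq, zero_smul, add_zero, one_smul, zero_mul, one_mul, sub_zero,
    one_pow, mul_one] at key
  linarith

/-- **STRONG MONOTONICITY OF THE GRADIENT**: a `C²` function whose second differences are
`≥ K|h|²` satisfies `Df(x₀)(x−x₀) + K|x−x₀|² ≤ Df(x)(x−x₀)`. [folklore] -/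
theorem meanMode_fderiv_strongMono {f : (Fin n → ℝ) → ℝ} (hf : ContDiff ℝ 2 f) {K : ℝ}
    (h2 : ∀ x h : Fin n → ℝ, K * (h ⬝ᵥ h) ≤ f (x + h) + f (x - h) - 2 * f x) (x₀ x : Fin n → ℝ) :
    fderiv ℝ f x₀ (x - x₀) + K * ((x - x₀) ⬝ᵥ (x - x₀)) ≤ fderiv ℝ f x (x - x₀) := by
  set v := x - x₀ with hv
  set q : ℝ → ℝ := fun t => fderiv ℝ f (x₀ + t • v) v with hq
  have hq' : ∀ t, HasDerivAt q (fderiv ℝ (fderiv ℝ f) (x₀ + t • v) v v) t := fun t =>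
    meanMode_hasDerivAt_fderiv_comp_path hf x₀ v v t
  have hqd : Differentiable ℝ q := fun t => (hq' t).differentiableAt
  have hqge : ∀ t, K * (v ⬝ᵥ v) ≤ deriv q t := fun t => by
    rw [(hq' t).deriv]; exact le_fderiv_fderiv_of_le_secondDiff hf h2 _ v
  have h := mul_sub_le_image_sub_of_le_deriv hqd hqge (zero_le_one (α := ℝ))
  have e1 : x₀ + (1:ℝ) • v = x := by rw [one_smul, hv]; abel
  simp only [hq, zero_smul, add_zero, e1, sub_zero, mul_one] at h
  linarith

/-- **MIXED LIPSCHITZ BOUND** (the defect `∇A − (x − x₀)` is `δ`-Lipschitz, polarised form): under the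
whitened sandwich, `|DA(x)w − DA(x₀)w − (x−x₀)·w| ≤ (δ/2)(|x−x₀|² + |w|²)`. [folklore] -/
theorem meanMode_abs_fderiv_defect_le {A : (Fin n → ℝ) → ℝ} (hA : ContDiff ℝ 2 A) {δ : ℝ}
    (hsw : ∀ x h : Fin n → ℝ, (1 - δ) * (h ⬝ᵥ h) ≤ A (x + h) + A (x - h) - 2 * A x ∧
      A (x + h) + A (x - h) - 2 * A x ≤ (1 + δ) * (h ⬝ᵥ h)) (x₀ x w : Fin n → ℝ) :
    |fderiv ℝ A x w - fderiv ℝ A x₀ w - (x - x₀) ⬝ᵥ w| ≤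
      δ / 2 * ((x - x₀) ⬝ᵥ (x - x₀) + w ⬝ᵥ w) := by
  set v := x - x₀ with hv
  set p : ℝ → ℝ := fun t => fderiv ℝ A (x₀ + t • v) w - t * (v ⬝ᵥ w) with hp
  have hp' : ∀ t, HasDerivAt p (fderiv ℝ (fderiv ℝ A) (x₀ + t • v) v w - v ⬝ᵥ w) t := by
    intro t
    have h1 := meanMode_hasDerivAt_fderiv_comp_path hA x₀ v w t
    have h2 : HasDerivAt (fun s : ℝ => s * (v ⬝ᵥ w)) (v ⬝ᵥ w) t := by
      simpa using hasDerivAt_mul_const (v ⬝ᵥ w) (x := t)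
    exact h1.sub h2
  have hbound : ∀ t ∈ Set.Ico (0:ℝ) 1, ‖fderiv ℝ (fderiv ℝ A) (x₀ + t • v) v w - v ⬝ᵥ w‖ ≤
      δ / 2 * (v ⬝ᵥ v + w ⬝ᵥ w) := fun t _ => by
    rw [Real.norm_eq_abs]
    exact abs_fderiv_fderiv_sub_dot_le hA hsw _ v w
  have hmvt := norm_image_sub_le_of_norm_deriv_le_segment_01' (f := p)
    (fun t _ => (hp' t).hasDerivWithinAt) hbound
  have e1 : x₀ + (1:ℝ) • v = x := by rw [one_smul, hv]; abel
  simp only [hp, e1, one_mul, zero_smul, add_zero, zero_mul, sub_zero, Real.norm_eq_abs] at hmvt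
  have e2 : fderiv ℝ A x w - v ⬝ᵥ w - fderiv ℝ A x₀ w = fderiv ℝ A x w - fderiv ℝ A x₀ w - v ⬝ᵥ w := by
    ring
  rw [e2] at hmvt
  exact hmvt

/-! ## §2 Two integration-by-parts identities -/

/-- `∫ ∂_wA · e^{−A} = 0` (Stein identity, constant direction). [folklore] -/
theorem meanMode_integral_fderiv_const {A : (Fin n → ℝ) → ℝ} (hA : ContDiff ℝ 2 A) {δ : ℝ}
    (hδ : 0 ≤ δ) (hδ1 : δ < 1)
    (hsw : ∀ x h : Fin n → ℝ, (1 - δ) * (h ⬝ᵥ h) ≤ A (x + h) + A (x - h) - 2 * A x ∧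
      A (x + h) + A (x - h) - 2 * A x ≤ (1 + δ) * (h ⬝ᵥ h)) (w : Fin n → ℝ) :
    ∫ x, fderiv ℝ A x w * exp (-A x) = 0 := by
  have h := integral_mul_fderiv_affine_mul_exp_neg hA hδ hδ1 hsw 0 w (F := fun _ => (1:ℝ))
    contDiff_const (DF := 1) (DF' := 0)
    (fun x => by
      rw [abs_one, one_mul]
      exact one_le_pow₀ (by linarith [norm_nonneg x]))
    (fun x j => by simp)
  simpa [Matrix.zero_mulVec] using h

/-- `∫ ∂_{x−x₀}A · e^{−A} = n · ∫ e^{−A}` (Stein identity, radial affine field). [folklore] -/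
theorem meanMode_integral_fderiv_radial {A : (Fin n → ℝ) → ℝ} (hA : ContDiff ℝ 2 A) {δ : ℝ}
    (hδ : 0 ≤ δ) (hδ1 : δ < 1)
    (hsw : ∀ x h : Fin n → ℝ, (1 - δ) * (h ⬝ᵥ h) ≤ A (x + h) + A (x - h) - 2 * A x ∧
      A (x + h) + A (x - h) - 2 * A x ≤ (1 + δ) * (h ⬝ᵥ h)) (x₀ : Fin n → ℝ) :
    ∫ x, fderiv ℝ A x (x - x₀) * exp (-A x) = n * ∫ x, exp (-A x) := by
  have h := integral_mul_fderiv_affine_mul_exp_neg hA hδ hδ1 hsw 1 (-x₀) (F := fun _ => (1:ℝ))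
    contDiff_const (DF := 1) (DF' := 0)
    (fun x => by
      rw [abs_one, one_mul]
      exact one_le_pow₀ (by linarith [norm_nonneg x]))
    (fun x j => by simp)
  have e1 : (fun x : Fin n → ℝ => (1:ℝ) * fderiv ℝ A x ((1 : Matrix (Fin n) (Fin n) ℝ).mulVec x + -x₀)
      * exp (-A x)) = fun x => fderiv ℝ A x (x - x₀) * exp (-A x) := by
    funext x; simp [Matrix.one_mulVec, sub_eq_add_neg]
  have e2 : (fun x : Fin n → ℝ => (fderiv ℝ (fun _ : Fin n → ℝ => (1:ℝ)) x
      ((1 : Matrix (Fin n) (Fin n) ℝ).mulVec x + -x₀) + (1 : Matrix (Fin n) (Fin n) ℝ).trace * 1)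
      * exp (-A x)) = fun x => (n : ℝ) * exp (-A x) := by
    funext x; simp [Matrix.trace_one, Fintype.card_fin]
  rw [e1, e2, integral_const_mul] at h
  exact h

/-! ## §3 The smooth-case moment inequalities -/

/-- Sup-norm growth of `x ↦ w·(x − x₀)`: `|w·(x−x₀)| ≤ (Σ|wᵢ|)(1+‖x₀‖)·(1+‖x‖)`. [folklore] -/
theorem meanMode_abs_dot_sub_le (w x₀ x : Fin n → ℝ) :
    |w ⬝ᵥ (x - x₀)| ≤ (∑ i, |w i|) * (1 + ‖x₀‖) * (1 + ‖x‖) ^ 1 := by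
  rw [pow_one]
  have h1 : |w ⬝ᵥ (x - x₀)| ≤ (∑ i, |w i|) * ‖x - x₀‖ := by
    calc |w ⬝ᵥ (x - x₀)| = |∑ i, w i * (x - x₀) i| := rfl
      _ ≤ ∑ i, |w i * (x - x₀) i| := Finset.abs_sum_le_sum_abs _ _
      _ ≤ ∑ i, |w i| * ‖x - x₀‖ := Finset.sum_le_sum fun i _ => by
          rw [abs_mul]
          refine mul_le_mul_of_nonneg_left ?_ (abs_nonneg _)
          simpa [Real.norm_eq_abs] using norm_le_pi_norm (x - x₀) i
      _ = (∑ i, |w i|) * ‖x - x₀‖ := by rw [Finset.sum_mul]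
  have h2 : ‖x - x₀‖ ≤ (1 + ‖x₀‖) * (1 + ‖x‖) := by
    have := norm_sub_le x x₀
    nlinarith [norm_nonneg x, norm_nonneg x₀]
  calc |w ⬝ᵥ (x - x₀)| ≤ (∑ i, |w i|) * ‖x - x₀‖ := h1
    _ ≤ (∑ i, |w i|) * ((1 + ‖x₀‖) * (1 + ‖x‖)) :=
        mul_le_mul_of_nonneg_left h2 (Finset.sum_nonneg fun i _ => abs_nonneg _)
    _ = (∑ i, |w i|) * (1 + ‖x₀‖) * (1 + ‖x‖) := by ring

/-- Sup-norm growth of `x ↦ |x − x₀|²`: `|x−x₀|² ≤ n(1+‖x₀‖)²·(1+‖x‖)²`. [folklore] -/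
theorem meanMode_dot_sub_self_le (x₀ x : Fin n → ℝ) :
    |(x - x₀) ⬝ᵥ (x - x₀)| ≤ (n : ℝ) * (1 + ‖x₀‖) ^ 2 * (1 + ‖x‖) ^ 2 := by
  rw [abs_of_nonneg (by simpa using dotProduct_self_star_nonneg (x - x₀))]
  have h1 := dotProduct_self_le_card_mul_norm_sq (x - x₀)
  have h2 : ‖x - x₀‖ ≤ (1 + ‖x₀‖) * (1 + ‖x‖) := by
    have := norm_sub_le x x₀
    nlinarith [norm_nonneg x, norm_nonneg x₀]
  have h3 : ‖x - x₀‖ ^ 2 ≤ ((1 + ‖x₀‖) * (1 + ‖x‖)) ^ 2 :=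
    pow_le_pow_left₀ (norm_nonneg _) h2 2
  calc (x - x₀) ⬝ᵥ (x - x₀) ≤ (n : ℝ) * ‖x - x₀‖ ^ 2 := h1
    _ ≤ (n : ℝ) * ((1 + ‖x₀‖) * (1 + ‖x‖)) ^ 2 := mul_le_mul_of_nonneg_left h3 (Nat.cast_nonneg n)
    _ = (n : ℝ) * (1 + ‖x₀‖) ^ 2 * (1 + ‖x‖) ^ 2 := by ring

/-- Sup-norm growth of a fixed linear functional on `x − x₀`: `|L(x−x₀)| ≤ ‖L‖(1+‖x₀‖)·(1+‖x‖)`.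
[folklore] -/
theorem meanMode_abs_clm_sub_le (L : (Fin n → ℝ) →L[ℝ] ℝ) (x₀ x : Fin n → ℝ) :
    |L (x - x₀)| ≤ ‖L‖ * (1 + ‖x₀‖) * (1 + ‖x‖) ^ 1 := by
  rw [pow_one]
  have h1 : |L (x - x₀)| ≤ ‖L‖ * ‖x - x₀‖ := by
    rw [← Real.norm_eq_abs]; exact L.le_opNorm _
  have h2 : ‖x - x₀‖ ≤ (1 + ‖x₀‖) * (1 + ‖x‖) := by
    have := norm_sub_le x x₀
    nlinarith [norm_nonneg x, norm_nonneg x₀]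
  calc |L (x - x₀)| ≤ ‖L‖ * ‖x - x₀‖ := h1
    _ ≤ ‖L‖ * ((1 + ‖x₀‖) * (1 + ‖x‖)) := mul_le_mul_of_nonneg_left h2 (norm_nonneg _)
    _ = ‖L‖ * (1 + ‖x₀‖) * (1 + ‖x‖) := by ring

/-- **(S1) SMOOTH FIRST-MOMENT INEQUALITY**: under the whitened sandwich (`0 ≤ δ < 1`, `A ∈ C²`),
for every base point `x₀` and direction `w`,
`|∫ w·(x−x₀) e^{−A} + ∂_wA(x₀)·∫e^{−A}| ≤ (δ/2)·(∫ |x−x₀|² e^{−A} + |w|²·∫e^{−A})`. [folklore] -/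
theorem meanMode_firstMoment_smooth {A : (Fin n → ℝ) → ℝ} (hA : ContDiff ℝ 2 A) {δ : ℝ}
    (hδ : 0 ≤ δ) (hδ1 : δ < 1)
    (hsw : ∀ x h : Fin n → ℝ, (1 - δ) * (h ⬝ᵥ h) ≤ A (x + h) + A (x - h) - 2 * A x ∧
      A (x + h) + A (x - h) - 2 * A x ≤ (1 + δ) * (h ⬝ᵥ h)) (x₀ w : Fin n → ℝ) :
    |(∫ x, (w ⬝ᵥ (x - x₀)) * exp (-A x)) + fderiv ℝ A x₀ w * ∫ x, exp (-A x)| ≤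
      δ / 2 * ((∫ x, ((x - x₀) ⬝ᵥ (x - x₀)) * exp (-A x)) + (w ⬝ᵥ w) * ∫ x, exp (-A x)) := by
  have hAc : Continuous A := hA.continuous
  obtain ⟨C₀, κ, _, hκ, hlb⟩ := exists_quadratic_lower_of_sandwich hAc hδ1 hsw
  -- integrability of the four weights
  have hI0 : Integrable fun x => exp (-A x) := by
    have := integrable_mul_exp_neg_of_growth hAc continuous_const hκ (by norm_num : 0 ≤ 8) hlb
      (w := fun _ => (1:ℝ)) (D := 1) (fun x => by simp)
    simpa using this
  have hIw : Integrable fun x => (w ⬝ᵥ (x - x₀)) * exp (-A x) :=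
    integrable_mul_exp_neg_of_growth hAc (continuous_const.dotProduct (continuous_id.sub continuous_const))
      hκ (by norm_num : 1 ≤ 8) hlb (meanMode_abs_dot_sub_le w x₀)
  have hIV : Integrable fun x => ((x - x₀) ⬝ᵥ (x - x₀)) * exp (-A x) :=
    integrable_mul_exp_neg_of_growth hAc ((continuous_id.sub continuous_const).dotProduct
      (continuous_id.sub continuous_const)) hκ (by norm_num : 2 ≤ 8) hlb (meanMode_dot_sub_self_le x₀)
  obtain ⟨K, _, hK⟩ := exists_abs_fderiv_le_of_sandwich hA hδ hsw w
  have hId : Integrable fun x => fderiv ℝ A x w * exp (-A x) :=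
    integrable_mul_exp_neg_of_growth hAc (continuous_fderiv_apply_of_contDiff hA w) hκ
      (by norm_num : 2 ≤ 8) hlb hK
  -- the defect integrand
  set φ : (Fin n → ℝ) → ℝ := fun x => w ⬝ᵥ (x - x₀) + fderiv ℝ A x₀ w - fderiv ℝ A x w with hφ
  have hφb : ∀ x, |φ x| ≤ δ / 2 * ((x - x₀) ⬝ᵥ (x - x₀) + w ⬝ᵥ w) := by
    intro x
    have h := meanMode_abs_fderiv_defect_le hA hsw x₀ x w
    rw [dotProduct_comm (x - x₀) w] at h
    have e : φ x = -(fderiv ℝ A x w - fderiv ℝ A x₀ w - w ⬝ᵥ (x - x₀)) := by simp only [hφ]; ring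
    rw [e, abs_neg]; exact h
  have hIφ : Integrable fun x => φ x * exp (-A x) := by
    have e : (fun x => φ x * exp (-A x)) = fun x =>
        (w ⬝ᵥ (x - x₀)) * exp (-A x) + fderiv ℝ A x₀ w * exp (-A x) - fderiv ℝ A x w * exp (-A x) := by
      funext x; simp only [hφ]; ring
    rw [e]; exact (hIw.add (hI0.const_mul _)).sub hId
  -- the identity `I_w + ∂_wA(x₀) Z = ∫ φ e^{−A}`
  have hident : (∫ x, (w ⬝ᵥ (x - x₀)) * exp (-A x)) + fderiv ℝ A x₀ w * ∫ x, exp (-A x) =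
      ∫ x, φ x * exp (-A x) := by
    have e : (fun x => φ x * exp (-A x)) = fun x =>
        ((w ⬝ᵥ (x - x₀)) * exp (-A x) + fderiv ℝ A x₀ w * exp (-A x)) - fderiv ℝ A x w * exp (-A x) := by
      funext x; simp only [hφ]; ring
    have hI12 : Integrable fun x => (w ⬝ᵥ (x - x₀)) * exp (-A x) + fderiv ℝ A x₀ w * exp (-A x) :=
      hIw.add (hI0.const_mul _)
    rw [e, integral_sub hI12 hId, integral_add hIw (hI0.const_mul _),
      integral_const_mul, meanMode_integral_fderiv_const hA hδ hδ1 hsw w, sub_zero]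
  rw [hident]
  -- bound the integral of the defect
  have hbound : Integrable fun x => δ / 2 * ((x - x₀) ⬝ᵥ (x - x₀) + w ⬝ᵥ w) * exp (-A x) := by
    have e : (fun x => δ / 2 * ((x - x₀) ⬝ᵥ (x - x₀) + w ⬝ᵥ w) * exp (-A x)) = fun x =>
        δ / 2 * (((x - x₀) ⬝ᵥ (x - x₀)) * exp (-A x)) + δ / 2 * (w ⬝ᵥ w) * exp (-A x) := by
      funext x; ring
    rw [e]; exact (hIV.const_mul _).add (hI0.const_mul _)
  calc |∫ x, φ x * exp (-A x)| ≤ ∫ x, |φ x * exp (-A x)| := abs_integral_le_integral_abs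
    _ ≤ ∫ x, δ / 2 * ((x - x₀) ⬝ᵥ (x - x₀) + w ⬝ᵥ w) * exp (-A x) := by
        refine integral_mono hIφ.abs hbound fun x => ?_
        simp only
        rw [abs_mul, abs_of_pos (exp_pos _)]
        exact mul_le_mul_of_nonneg_right (hφb x) (exp_pos _).le
    _ = δ / 2 * ((∫ x, ((x - x₀) ⬝ᵥ (x - x₀)) * exp (-A x)) + (w ⬝ᵥ w) * ∫ x, exp (-A x)) := by
        have e : (fun x => δ / 2 * ((x - x₀) ⬝ᵥ (x - x₀) + w ⬝ᵥ w) * exp (-A x)) = fun x =>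
            δ / 2 * (((x - x₀) ⬝ᵥ (x - x₀)) * exp (-A x)) + δ / 2 * (w ⬝ᵥ w) * exp (-A x) := by
          funext x; ring
        rw [e, integral_add (hIV.const_mul _) (hI0.const_mul _), integral_const_mul, integral_const_mul]
        ring

/-- **(S2) SMOOTH SECOND-MOMENT INEQUALITY** (equipartition about `x₀`): under the whitened sandwich
(`0 ≤ δ < 1`, `A ∈ C²`), `(1−δ)·∫ |x−x₀|² e^{−A} ≤ n·∫e^{−A} − ∫ ∂_{x−x₀}A(x₀) e^{−A}`. [folklore] -/
theorem meanMode_secondMoment_smooth {A : (Fin n → ℝ) → ℝ} (hA : ContDiff ℝ 2 A) {δ : ℝ}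
    (hδ : 0 ≤ δ) (hδ1 : δ < 1)
    (hsw : ∀ x h : Fin n → ℝ, (1 - δ) * (h ⬝ᵥ h) ≤ A (x + h) + A (x - h) - 2 * A x ∧
      A (x + h) + A (x - h) - 2 * A x ≤ (1 + δ) * (h ⬝ᵥ h)) (x₀ : Fin n → ℝ) :
    (1 - δ) * ∫ x, ((x - x₀) ⬝ᵥ (x - x₀)) * exp (-A x) ≤
      n * (∫ x, exp (-A x)) - ∫ x, fderiv ℝ A x₀ (x - x₀) * exp (-A x) := by
  have hAc : Continuous A := hA.continuous
  obtain ⟨C₀, κ, _, hκ, hlb⟩ := exists_quadratic_lower_of_sandwich hAc hδ1 hsw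
  have hIV : Integrable fun x => ((x - x₀) ⬝ᵥ (x - x₀)) * exp (-A x) :=
    integrable_mul_exp_neg_of_growth hAc ((continuous_id.sub continuous_const).dotProduct
      (continuous_id.sub continuous_const)) hκ (by norm_num : 2 ≤ 8) hlb (meanMode_dot_sub_self_le x₀)
  have hIL : Integrable fun x => fderiv ℝ A x₀ (x - x₀) * exp (-A x) :=
    integrable_mul_exp_neg_of_growth hAc ((fderiv ℝ A x₀).continuous.comp (continuous_id.sub
      continuous_const)) hκ (by norm_num : 1 ≤ 8) hlb (meanMode_abs_clm_sub_le (fderiv ℝ A x₀) x₀)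
  obtain ⟨D, _, hD⟩ := exists_abs_fderiv_affine_le hA hδ hsw 1 (-x₀)
  have hIR : Integrable fun x => fderiv ℝ A x (x - x₀) * exp (-A x) := by
    refine integrable_mul_exp_neg_of_growth hAc ((hA.continuous_fderiv (by norm_num)).clm_apply
      (continuous_id.sub continuous_const)) hκ (by norm_num : 3 ≤ 8) hlb (D := D) fun x => ?_
    have := hD x
    simpa [Matrix.one_mulVec, sub_eq_add_neg] using this
  -- pointwise strong monotonicity, integrated
  have hpt : ∀ x, (fderiv ℝ A x₀ (x - x₀) + (1 - δ) * ((x - x₀) ⬝ᵥ (x - x₀))) * exp (-A x) ≤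
      fderiv ℝ A x (x - x₀) * exp (-A x) := fun x =>
    mul_le_mul_of_nonneg_right (meanMode_fderiv_strongMono hA (fun y h => (hsw y h).1) x₀ x) (exp_pos _).le
  have hsum : Integrable fun x => (fderiv ℝ A x₀ (x - x₀) + (1 - δ) * ((x - x₀) ⬝ᵥ (x - x₀))) * exp (-A x) := by
    have e : (fun x => (fderiv ℝ A x₀ (x - x₀) + (1 - δ) * ((x - x₀) ⬝ᵥ (x - x₀))) * exp (-A x)) =
        fun x => fderiv ℝ A x₀ (x - x₀) * exp (-A x) + (1 - δ) * (((x - x₀) ⬝ᵥ (x - x₀)) * exp (-A x)) := by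
      funext x; ring
    rw [e]; exact hIL.add (hIV.const_mul _)
  have h := integral_mono hsum hIR hpt
  have e : (∫ x, (fderiv ℝ A x₀ (x - x₀) + (1 - δ) * ((x - x₀) ⬝ᵥ (x - x₀))) * exp (-A x)) =
      (∫ x, fderiv ℝ A x₀ (x - x₀) * exp (-A x)) + (1 - δ) * ∫ x, ((x - x₀) ⬝ᵥ (x - x₀)) * exp (-A x) := by
    have e' : (fun x => (fderiv ℝ A x₀ (x - x₀) + (1 - δ) * ((x - x₀) ⬝ᵥ (x - x₀))) * exp (-A x)) =
        fun x => fderiv ℝ A x₀ (x - x₀) * exp (-A x) + (1 - δ) * (((x - x₀) ⬝ᵥ (x - x₀)) * exp (-A x)) := by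
      funext x; ring
    rw [e', integral_add hIL (hIV.const_mul _), integral_const_mul]
  rw [e, meanMode_integral_fderiv_radial hA hδ hδ1 hsw x₀] at h
  linarith

end Summit.QuantumFields.YangMills.Theorems.SandwichVariancePinching

end
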